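import Summits.BirchSwinnertonDyer.BirchSwinnertonDyer.Theorems.GenusKolyvaginAtTwoShaCardDvdPowAtTwoRTPairSandwichFrame
import Summits.BirchSwinnertonDyer.BirchSwinnertonDyer.Theorems.GenusKolyvaginAtTwoShaCardDvdPowAtTwoRTShaFiniteAtTwoCTQ
import Summits.BirchSwinnertonDyer.BirchSwinnertonDyer.Theorems.GenusKolyvaginAtTwoPowDvdShaCardAtTwoPosTLadderFrame
import Summits.BirchSwinnertonDyer.BirchSwinnertonDyer.Theorems.GenusKolyvaginAtTwoPowDvdShaCardAtTwoPosTArchimedeanBitTorsor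
import HarnessLib

/-!
# Route `GenusKolyvaginAtTwo`, cruxes U_T′ `ShaCardDvdPowAtTwoRT` (stmt-BirchSwinnertonDyer-23469, `Δ < 0`) and U⁺_T `ShaCardDvdPowAtTwoPosT`
# (stmt-BirchSwinnertonDyer-23378, `Δ > 0`): THE PAIR SANDWICH, SIGN-FREE AND REDUCTION-TYPE-FREE —
# `2 · #Ш(E/K)[2^∞] ≤ (#Ш(E/ℚ)[2^∞] · A) · (#Ш(E^(d_K)/ℚ)[2^∞] · A′)` from the FRAME alone, and `#Ш(E/K)[2^∞] ∣ 4^(M₀)` from the `ℚ`-side exponent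

Seat `bsd-line-gk2-p3` g27 (PROVER seat 3/3, cell `bsd-f1-sign2`), `--supports` (helper; closes nothing).  THEOREMS ONLY (no definition, no
named fact, no `sorry`); standard axioms.  BSD is NOT proved by any of this; U_T′ / U⁺_T / Q4_T are NOT proved by this file.

WHAT (sequel of `…RTPairSandwichFrame`, §1–§2 there).  `X = Ш(E/K)[2^∞]`, `T = E^(d_K) = W.quadraticTwist (discr K)`, `A = [res⁻¹Ш(E_K) : Ш(E/ℚ) ∩ ·]`,
`A′ = [res′⁻¹Ш(T_K) : Ш(T/ℚ) ∩ ·]` (the relaxed indices).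

* §3 `finite_and_two_mul_natCard_sha_le_pair_of_frame` — from the frame (`K` imaginary quadratic, `σ ≠ 1`, `E(K)[2] = 0`, `rank E(K) ≤ 1`,
  `y ∈ E(K)` with `σy + y` torsion and `2^(M+1) ∤ y`), finiteness of `Ш(E/ℚ)[2^∞]`, `Ш(T/ℚ)[2^∞]` and `A, A′ ≠ 0`: **`X` IS FINITE and
  `2 · #X ≤ (#Ш(E/ℚ)[2^∞] · A) · (#Ш(T/ℚ)[2^∞] · A′)`**.  Mechanism = LEAD gk2-p1 g19's SANDWICH′ assembly + gk2-p3 g26's (A), re-run: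
  `#X = #ker(δ|X) · #δX` (`δ = 1 − τ_*`); `ker ⊆ res(res⁻¹X)` (invariant classes are restrictions) with `#res(res⁻¹X) ≤ #res⁻¹X / 2` (the Kramer class);
  `δX = ψ_*(res′(cor′ψ_*⁻¹X)) ⊆ ψ_*(res′(res′⁻¹X′))` (twist transport with sign); both relaxed groups finite and counted by §2.
  `natCard_sha_dvd_pow_of_pair_of_frame` — THE NUMERICAL CLOSER: in addition `Ш(T/ℚ)[2^∞] = 0` (2-Selmer-minimal twin), `2^(M₀) · Ш(E/ℚ)[2^∞] = 0`
  (B2Q-shape: Kolyvagin's Theorem B₂ over `ℚ`, DISPLAYED), `#Ш(E/ℚ)[2] ≤ 4` (RANKQ) and `A · A′ ≤ 4`: **`#Ш(E/K)[2^∞] ∣ 4^(M₀)`** (filtration count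
  `#Y ≤ #Y[2]^(M₀)`; `#X = 4^t` by Cassels–Tate over `K`, unconditional in the tree).
* §4 the two budgets `A · A′ ≤ 4`: `relIndex_mul_relIndex_le_four_of_Δ_neg` (`Δ < 0`, `ord₂ C(Wd) ≤ 1` — LINE 19's cut; gk2-p3 g17/g18) and
  **`relIndex_mul_relIndex_le_four_of_padicValNat_eq_zero`** (ANY sign, `ord₂ C(Wd) = 0` — the TAMAGAWA-ODD twin; the ARCHIMEDEAN BIT, pen
  bsd-idea-1 g12 / `…PosTArchimedeanBitTorsor`, on top of gk2-p3 g18's `…PosTLadderFrame`).  On `Δ > 0` every prime of `d_K` is then silent.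

CONSEQUENCE (sequel file `…PosTOnCut`): on BOTH signs the upper half of Kolyvagin-exactness at `2` on the cut is «`ℚ`-side sharp exponent + RANKQ»,
nothing K-side: LINE 19's U_T′ = this ∘ B2Q (gk2-p4 g22); U⁺_T (23378) on the odd-twin cut = this ∘ B2Q⁺ (LINE 16_T's layer one, regular primes).
HONEST FRAMING: descent algebra re-assembled; the Kolyvagin input is a displayed hypothesis; beyond print: no.  BSD is NOT proved; no item closed.

References: [Kramer1981] Thm. 1, §2 Prop. 3, proof of Thm. 2; [GrossLMS1991] §5 (5.1)–(5.3); [SerreGaloisCohomology1997] I §2.6 (b), §5.8;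
[MilneADT2006] I Rem. 3.7, Thm. 6.13; [Kolyvagin1989Izv] Thm. B₂; [McCallumLMS1991] §5 Cor. 5.6; [Fuchs1970] §8 Thm. 8.4; [SilvermanAEC2009] X.4.14.
-/

set_option autoImplicit false
set_option linter.dupNamespace false -- `Summit.<P>.<Sub>` repeats `BirchSwinnertonDyer` (D-0017)

noncomputable section

open scoped Classical

namespace Summit.BirchSwinnertonDyer.BirchSwinnertonDyer.Theorems.GenusExact.PlusDescent

open Literature.NumberTheory.EllipticCurves Literature.NumberTheory.GaloisRepresentations WeierstrassCurve NumberField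
  IsDedekindDomain Field AddSubgroup
open Summit.BirchSwinnertonDyer.Rank1Residual
open Summit.BirchSwinnertonDyer.BirchSwinnertonDyer.Theorems.GenusExact.RegularPlusDescent (archimedeanBit_sha_comap_resBaseChange
  relIndex_sha_comap_resBaseChange_le_two_pow_succ_of_arch relIndex_sha_comap_resBaseChange_twin_le_two_pow_succ_of_arch)
open Summit.BirchSwinnertonDyer.BirchSwinnertonDyer.Theorems.GenusExact.SelmerDescent (mem_comap_resBaseChange_shaPrimary_iff
  two_nsmul_eq_zero_of_resBaseChange_eq_zero)


/-! ## §3 Finiteness of `Ш(E/K)[2^∞]` from the two `ℚ`-sides, and the two counts -/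

section Counts

variable (W : WeierstrassCurve ℚ) [W.IsElliptic] (K : Type) [Field K] [NumberField K]

set_option maxHeartbeats 800000 in -- one long elaboration: twist transport + two relaxed groups + two kernel/image counts
/-- **THE PAIR SANDWICH FROM THE FRAME ALONE.**  `E = W/ℚ` elliptic; `K` imaginary quadratic (`[K:ℚ] = 2`), `σ ≠ 1`; the frame of §1
(`E(K)[2] = 0`, `rank E(K) ≤ 1`, `y ∈ E(K)` with `σy + y` torsion and `2^(M+1) ∤ y`); the two `ℚ`-SIDES `Ш(E/ℚ)[2^∞]` and `Ш(T/ℚ)[2^∞]`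
(`T = E^(d_K) = W.quadraticTwist (discr K)`) FINITE; and the two relaxed indices `[res⁻¹Ш(E_K) : Ш(E/ℚ) ∩ ·]`, `[res′⁻¹Ш(T_K) : Ш(T/ℚ) ∩ ·]`
non-zero.  Then `Ш(E/K)[2^∞]` is FINITE and
**`2 · #Ш(E/K)[2^∞] ≤ (#Ш(E/ℚ)[2^∞] · [res⁻¹Ш(E_K) : Ш(E/ℚ) ∩ ·]) · (#Ш(T/ℚ)[2^∞] · [res′⁻¹Ш(T_K) : Ш(T/ℚ) ∩ ·])`**.
Mechanism (LEAD gk2-p1 g19 SANDWICH′ + gk2-p3 g26 (A), re-assembled): `X = Ш(E/K)[2^∞]`, `δ = 1 − τ_*`; `ker(δ|X) ⊆ res(res⁻¹X)` (§1: invariant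
classes are restrictions) with `#res(res⁻¹X) ≤ #res⁻¹X / 2` (§1: the Kramer class); `δ(X) = ψ_*(res′(cor′ ψ_*⁻¹ X)) ⊆ ψ_*(res′(res′⁻¹X′))`
(twist transport with sign, `(1 − τ_*)ψ_* = ψ_* res′ cor′`); both relaxed groups finite and counted by §2.
[cite: Kramer1981, Thm. 1, §2 Prop. 3, proof of Thm. 2] [cite: GrossLMS1991, §5 (5.1)–(5.3)] [cite: SerreGaloisCohomology1997, I §2.6 (b), §5.8] -/
theorem finite_and_two_mul_natCard_sha_le_pair_of_frame (hIQ : IsImaginaryQuadratic K) {σ : K ≃ₐ[ℚ] K} (hσ1 : σ ≠ 1)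
    (h2tors : ∀ P : (W.baseChange K).toAffine.Point, (2 : ℤ) • P = 0 → P = 0)
    (hrk : (W.baseChange K).mordellWeilRank ≤ 1)
    (y : (W.baseChange K).toAffine.Point) (M : ℕ)
    (hndiv : ∀ Q : (W.baseChange K).toAffine.Point, ((2 ^ (M + 1) : ℕ) : ℤ) • Q ≠ y)
    (hanti : IsOfFinAddOrder (Affine.Point.map (W' := W) (σ : K →ₐ[ℚ] K) y + y))
    [Finite (AddCommGroup.primaryComponent (↥W.sha) 2)]
    (hfinT : haveI := W.isElliptic_quadraticTwist (show (NumberField.discr K : ℚ) ≠ 0 by exact_mod_cast NumberField.discr_ne_zero K)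
      Finite (AddCommGroup.primaryComponent (↥(W.quadraticTwist (NumberField.discr K : ℚ)).sha) 2))
    (hne : (W.sha).relIndex (((W.baseChange K).sha).comap (resBaseChange W K)) ≠ 0)
    (hneT : haveI := W.isElliptic_quadraticTwist (show (NumberField.discr K : ℚ) ≠ 0 by exact_mod_cast NumberField.discr_ne_zero K)
      ((W.quadraticTwist (NumberField.discr K : ℚ)).sha).relIndex
        ((((W.quadraticTwist (NumberField.discr K : ℚ)).baseChange K).sha).comap
          (resBaseChange (W.quadraticTwist (NumberField.discr K : ℚ)) K)) ≠ 0) :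
    haveI := W.isElliptic_quadraticTwist (show (NumberField.discr K : ℚ) ≠ 0 by exact_mod_cast NumberField.discr_ne_zero K)
    Finite (AddCommGroup.primaryComponent (↥(W.baseChange K).sha) 2) ∧
      2 * Nat.card (AddCommGroup.primaryComponent (↥(W.baseChange K).sha) 2) ≤
        (Nat.card (AddCommGroup.primaryComponent (↥W.sha) 2) * (W.sha).relIndex (((W.baseChange K).sha).comap (resBaseChange W K))) *
        (Nat.card (AddCommGroup.primaryComponent (↥(W.quadraticTwist (NumberField.discr K : ℚ)).sha) 2) *
          ((W.quadraticTwist (NumberField.discr K : ℚ)).sha).relIndex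
            ((((W.quadraticTwist (NumberField.discr K : ℚ)).baseChange K).sha).comap
              (resBaseChange (W.quadraticTwist (NumberField.discr K : ℚ)) K))) := by
  haveI : Fact (Nat.Prime 2) := ⟨Nat.prime_two⟩
  have h2 : Module.finrank ℚ K = 2 := hIQ.1
  have hdK : (NumberField.discr K : ℚ) ≠ 0 := by exact_mod_cast NumberField.discr_ne_zero K
  haveI hTell : (W.quadraticTwist (NumberField.discr K : ℚ)).IsElliptic := W.isElliptic_quadraticTwist hdK
  haveI := hfinT
  have hK : ∀ w : InfinitePlace K, w.IsComplex := hIQ.2.isComplex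
  obtain ⟨τ, θ₀, hτ1, hθ₀Q, hθ₀, hτθ₀, hall⟩ := exists_gal_ne_one_sqrt_discr K h2
  obtain rfl : σ = τ := (hall σ).resolve_left hσ1
  obtain ⟨C, hC⟩ := W.exists_variableChange_quadraticTwist_one
  -- ### the objects
  set T := W.quadraticTwist (NumberField.discr K : ℚ) with hTdef
  set X : AddSubgroup ↥(W.baseChange K).sha := AddCommGroup.primaryComponent (↥(W.baseChange K).sha) 2 with hX
  set Xs : AddSubgroup (W.baseChange K).galH1 := X.map (W.baseChange K).sha.subtype with hXs
  set res := resBaseChange W K with hres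
  set R₂ : AddSubgroup W.galH1 := Xs.comap res with hR₂
  set X' : AddSubgroup ↥(T.baseChange K).sha := AddCommGroup.primaryComponent (↥(T.baseChange K).sha) 2 with hX'
  set Xs' : AddSubgroup (T.baseChange K).galH1 := X'.map (T.baseChange K).sha.subtype with hXs'
  set res' := resBaseChange T K with hres'
  set R₂' : AddSubgroup T.galH1 := Xs'.comap res' with hR₂'
  set δ : (W.baseChange K).galH1 →+ (W.baseChange K).galH1 :=
    AddMonoidHom.id (W.baseChange K).galH1 - (isLiftOfAut_liftAut σ).conjH1Points W with hδ
  set Φ := h1Equiv (twistIso W hθ₀Q hθ₀ hC) (twistIso_smul W hθ₀Q hθ₀ hC) with hΦ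
  set cor' := corBaseChange K T σ h2 hσ1 with hcor'
  -- ### §2 for `E` and for `T`: both relaxed groups finite and counted
  obtain ⟨hR₂fin, hR₂card⟩ := finite_and_natCard_comap_resBaseChange_shaPrimary_le_of_relIndex W K h2 hσ1 hne
  obtain ⟨hR₂'fin, hR₂'card⟩ := finite_and_natCard_comap_resBaseChange_shaPrimary_le_of_relIndex T K h2 hσ1 hneT
  haveI := hR₂fin
  haveI := hR₂'fin
  -- ### the key identity `(1 − τ_*)(ψ_* s) = ψ_*(res'(cor' s))`
  have hkey : ∀ s, δ (Φ s) = Φ (res' (cor' s)) := by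
    intro s
    rw [hres', hcor', resBaseChange_corBaseChange K T σ h2 hσ1 (isLiftOfAut_liftAut σ) s, map_add, hΦ,
      h1Equiv_twistIso_conjH1Points W hθ₀Q hθ₀ hC (isLiftOfAut_liftAut σ) hτθ₀ s, hδ, AddMonoidHom.sub_apply,
      AddMonoidHom.id_apply, sub_eq_add_neg]
  set π : (W.baseChange K).galH1 →+ T.galH1 := cor'.comp Φ.symm.toAddMonoidHom with hπ
  have hπapp : ∀ x, Φ (res' (π x)) = δ x := fun x ↦ by
    rw [hπ, AddMonoidHom.comp_apply, AddEquiv.coe_toAddMonoidHom, ← hkey, AddEquiv.apply_symm_apply]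
  -- ### `π(Xs) ⊆ R₂'`
  have hπmem : ∀ x ∈ Xs, π x ∈ R₂' := by
    intro x hx
    obtain ⟨x', hx', rfl⟩ := AddSubgroup.mem_map.mp hx
    obtain ⟨k, hk⟩ := (AddCommGroup.mem_primaryComponent).mp hx'
    have hxsha : ((x' : ↥(W.baseChange K).sha) : (W.baseChange K).galH1) ∈ (W.baseChange K).sha := x'.2
    -- `res'(π x) ∈ Ш(T_K)`
    have hs : Φ.symm ((x' : ↥(W.baseChange K).sha) : (W.baseChange K).galH1) ∈ (T.baseChange K).sha := by
      rw [mem_sha_iff_h1Equiv_twistIso_mem W hθ₀Q hθ₀ hC, ← hΦ, AddEquiv.apply_symm_apply]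
      exact hxsha
    have hsha' : res' (π ((x' : ↥(W.baseChange K).sha) : (W.baseChange K).galH1)) ∈ (T.baseChange K).sha := by
      rw [hπ, AddMonoidHom.comp_apply, AddEquiv.coe_toAddMonoidHom, hres', hcor',
        resBaseChange_corBaseChange K T σ h2 hσ1 (isLiftOfAut_liftAut σ)]
      exact AddSubgroup.add_mem _ hs (SylvesterTwoShaConjugation.conjH1Points_mem_sha _ hK (isLiftOfAut_liftAut σ) hs)
    -- `2^k · res'(π x) = 0`
    have h0 : 2 ^ k • res' (π ((x' : ↥(W.baseChange K).sha) : (W.baseChange K).galH1)) = 0 := by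
      apply Φ.injective
      rw [map_nsmul, hπapp, map_zero, ← map_nsmul, ← AddSubgroupClass.coe_nsmul, hk, ZeroMemClass.coe_zero, map_zero]
    exact (mem_comap_resBaseChange_shaPrimary_iff T (K := K) _).mpr ⟨hsha', k, h0⟩
  -- ### `δ(Xs) ⊆ ψ_*(res'(R₂'))`, a finite group with at most `#R₂'` elements
  set M' : AddSubgroup (W.baseChange K).galH1 := (R₂'.map res').map Φ.toAddMonoidHom with hM'
  have hδle : Xs.map δ ≤ M' := by
    rintro _ ⟨x, hx, rfl⟩
    exact AddSubgroup.mem_map.mpr ⟨res' (π x), AddSubgroup.mem_map.mpr ⟨π x, hπmem x hx, rfl⟩, hπapp x⟩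
  have hM'card : Nat.card M' ≤ Nat.card R₂' := by
    refine Nat.card_le_card_of_surjective (fun r : R₂' ↦ (⟨Φ (res' (r : T.galH1)), ?_⟩ : M')) ?_
    · exact AddSubgroup.mem_map.mpr ⟨res' r, AddSubgroup.mem_map.mpr ⟨r, r.2, rfl⟩, rfl⟩
    · rintro ⟨m, hm⟩
      obtain ⟨z, hz, rfl⟩ := AddSubgroup.mem_map.mp hm
      obtain ⟨r, hr, rfl⟩ := AddSubgroup.mem_map.mp hz
      exact ⟨⟨r, hr⟩, rfl⟩
  haveI hM'fin : Finite M' := by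
    have h : (M' : Set (W.baseChange K).galH1).Finite := by
      rw [hM', AddSubgroup.coe_map, AddSubgroup.coe_map]
      exact ((Set.toFinite _).image _).image _
    exact h.to_subtype
  have hδcard : Nat.card (Xs.map δ) ≤ Nat.card R₂' := (AddSubgroup.card_le_of_le hδle).trans hM'card
  -- ### `ker(δ|Xs) ↪ res(R₂)`: invariant classes are restrictions (§1)
  have hjmem : ∀ k : (δ.comp Xs.subtype).ker, ((k : Xs) : (W.baseChange K).galH1) ∈ R₂.map res := by
    intro k
    have hk : (isLiftOfAut_liftAut σ).conjH1Points W ((k : Xs) : (W.baseChange K).galH1) = ((k : Xs) : (W.baseChange K).galH1) := by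
      have h := (AddMonoidHom.mem_ker).mp k.2
      change ((k : Xs) : (W.baseChange K).galH1) - (isLiftOfAut_liftAut σ).conjH1Points W ((k : Xs) : (W.baseChange K).galH1) = 0 at h
      exact (sub_eq_zero.mp h).symm
    obtain ⟨b, hb⟩ := exists_resBaseChange_eq_of_conjH1Points_eq_of_frame W K h2 hσ1 h2tors hrk y M hndiv hanti hk
    refine AddSubgroup.mem_map.mpr ⟨b, ?_, hb⟩
    rw [hR₂, AddSubgroup.mem_comap]
    have hb' : res b = ((k : Xs) : (W.baseChange K).galH1) := hb
    rw [hb']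
    exact (k : Xs).2
  let j : (δ.comp Xs.subtype).ker → R₂.map res := fun k ↦ ⟨((k : Xs) : (W.baseChange K).galH1), hjmem k⟩
  have hj : Function.Injective j := by
    intro k₁ k₂ h
    apply Subtype.ext
    apply Subtype.ext
    exact congrArg (fun z : R₂.map res ↦ (z : (W.baseChange K).galH1)) h
  haveI hRmapfin : Finite (R₂.map res) := by
    have h : ((R₂.map res : AddSubgroup (W.baseChange K).galH1) : Set (W.baseChange K).galH1).Finite := by
      rw [AddSubgroup.coe_map]; exact (Set.toFinite _).image _
    exact h.to_subtype
  have hkerle : Nat.card (δ.comp Xs.subtype).ker ≤ Nat.card (R₂.map res) := Nat.card_le_card_of_injective j hj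
  -- ### finiteness of `Xs`, `X`
  haveI hkerfin : Finite (δ.comp Xs.subtype).ker := Finite.of_injective j hj
  have hrange : (δ.comp Xs.subtype).range = Xs.map δ := by rw [AddMonoidHom.range_comp, AddSubgroup.range_subtype]
  haveI hrangefin : Finite (δ.comp Xs.subtype).range := by
    rw [hrange]
    exact Finite.of_injective (AddSubgroup.inclusion hδle) (AddSubgroup.inclusion_injective hδle)
  haveI hXsfin : Finite Xs := (AddMonoidHom.finite_iff_finite_ker_range (δ.comp Xs.subtype)).mpr ⟨hkerfin, hrangefin⟩
  have hXfin : Finite X :=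
    Finite.of_equiv _ (X.equivMapOfInjective (W.baseChange K).sha.subtype (W.baseChange K).sha.subtype_injective).toEquiv.symm
  refine ⟨hXfin, ?_⟩
  haveI := hXfin
  have hcardXs : Nat.card Xs = Nat.card X :=
    (Nat.card_congr (X.equivMapOfInjective (W.baseChange K).sha.subtype (W.baseChange K).sha.subtype_injective).toEquiv).symm
  -- ### `#Xs = #ker(δ|_Xs) · #δ(Xs)` and `#R₂ = #ker(res|_R₂) · #res(R₂)` with `#ker(res|_R₂) ≥ 2` (the Kramer class)
  have hsplit := natCard_eq_natCard_ker_mul_natCard_map Xs δ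
  set ρ : R₂ →+ (W.baseChange K).galH1 := res.comp R₂.subtype with hρdef
  have hRsplit : Nat.card R₂ = Nat.card ρ.ker * Nat.card (R₂.map res) := natCard_eq_natCard_ker_mul_natCard_map R₂ res
  obtain ⟨η, hη0, hηres⟩ := exists_ne_zero_resBaseChange_eq_zero_of_frame W K h2 hσ1 h2tors hrk y M hndiv hanti
  have hηR : η ∈ R₂ := by
    rw [hR₂, AddSubgroup.mem_comap]
    have h0 : res η = 0 := hηres
    rw [h0]
    exact Xs.zero_mem
  have hker2 : 2 ≤ Nat.card ρ.ker := by
    have hnt : Nontrivial ρ.ker := by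
      refine ⟨⟨⟨⟨η, hηR⟩, (AddMonoidHom.mem_ker).mpr ?_⟩, 0, fun h ↦ hη0 ?_⟩⟩
      · change res ((⟨η, hηR⟩ : R₂) : W.galH1) = 0
        exact hηres
      · exact congrArg (fun z : ρ.ker ↦ ((z : R₂) : W.galH1)) h
    exact Finite.one_lt_card_iff_nontrivial.mpr hnt
  have hmapR : 2 * Nat.card (R₂.map res) ≤ Nat.card R₂ := by
    calc 2 * Nat.card (R₂.map res) ≤ Nat.card ρ.ker * Nat.card (R₂.map res) := Nat.mul_le_mul_right _ hker2
      _ = Nat.card R₂ := hRsplit.symm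
  -- ### combine
  calc 2 * Nat.card X = 2 * (Nat.card (δ.comp Xs.subtype).ker * Nat.card (Xs.map δ)) := by rw [← hsplit, hcardXs]
    _ ≤ 2 * (Nat.card (R₂.map res) * Nat.card R₂') := Nat.mul_le_mul_left 2 (Nat.mul_le_mul hkerle hδcard)
    _ = (2 * Nat.card (R₂.map res)) * Nat.card R₂' := by ring
    _ ≤ Nat.card R₂ * Nat.card R₂' := Nat.mul_le_mul_right _ hmapR
    _ ≤ _ := Nat.mul_le_mul hR₂card hR₂'card

/-- **THE NUMERICAL CLOSER: `#Ш(E/K)[2^∞] ∣ 4^(M₀)` from the frame, the `ℚ`-side exponent, the `2`-rank over `ℚ` and the budget.**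
Same frame as `finite_and_two_mul_natCard_sha_le_pair_of_frame`; in addition `Ш(T/ℚ)[2^∞] = 0` (the `2`-Selmer-minimal twin), `2^(M₀)` kills
`Ш(E/ℚ)[2^∞]` (the B2Q-shape input — Kolyvagin's Theorem B₂ over `ℚ`), `#Ш(E/ℚ)[2] ≤ 4` (RANKQ) and the budget
`[res⁻¹Ш(E_K) : ·] · [res′⁻¹Ш(T_K) : ·] ≤ 4`.  Then `2 · #X ≤ #Ш(E/ℚ)[2^∞] · 4 ≤ 4^(M₀) · 4` (filtration count `#Y ≤ #Y[2]^(M₀)`),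
and `#X = 4^t` (Cassels–Tate over `K`, unconditional in the tree) forces `t ≤ M₀`.  NO habitat, NO sign of `Δ`, NO reduction type, NO Kolyvagin
descent over `K`.  [cite: Kramer1981, Thm. 1] [cite: GrossLMS1991, §5 (5.1)–(5.3)] [cite: Kolyvagin1989Izv, Thm. B₂] [cite: McCallumLMS1991, §5 Cor. 5.6]
[cite: Fuchs1970, §8 Thm. 8.4] [cite: SilvermanAEC2009, Thm. X.4.14] -/
theorem natCard_sha_dvd_pow_of_pair_of_frame (hIQ : IsImaginaryQuadratic K) {σ : K ≃ₐ[ℚ] K} (hσ1 : σ ≠ 1)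
    (h2tors : ∀ P : (W.baseChange K).toAffine.Point, (2 : ℤ) • P = 0 → P = 0)
    (hrk : (W.baseChange K).mordellWeilRank ≤ 1)
    (y : (W.baseChange K).toAffine.Point) (M : ℕ)
    (hndiv : ∀ Q : (W.baseChange K).toAffine.Point, ((2 ^ (M + 1) : ℕ) : ℤ) • Q ≠ y)
    (hanti : IsOfFinAddOrder (Affine.Point.map (W' := W) (σ : K →ₐ[ℚ] K) y + y))
    [Finite (AddCommGroup.primaryComponent (↥W.sha) 2)]
    (hT0 : haveI := W.isElliptic_quadraticTwist (show (NumberField.discr K : ℚ) ≠ 0 by exact_mod_cast NumberField.discr_ne_zero K)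
      ∀ x ∈ AddCommGroup.primaryComponent (↥(W.quadraticTwist (NumberField.discr K : ℚ)).sha) 2, x = 0)
    (hne : (W.sha).relIndex (((W.baseChange K).sha).comap (resBaseChange W K)) ≠ 0)
    (hneT : haveI := W.isElliptic_quadraticTwist (show (NumberField.discr K : ℚ) ≠ 0 by exact_mod_cast NumberField.discr_ne_zero K)
      ((W.quadraticTwist (NumberField.discr K : ℚ)).sha).relIndex
        ((((W.quadraticTwist (NumberField.discr K : ℚ)).baseChange K).sha).comap
          (resBaseChange (W.quadraticTwist (NumberField.discr K : ℚ)) K)) ≠ 0)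
    (hbudget : haveI := W.isElliptic_quadraticTwist (show (NumberField.discr K : ℚ) ≠ 0 by exact_mod_cast NumberField.discr_ne_zero K)
      (W.sha).relIndex (((W.baseChange K).sha).comap (resBaseChange W K)) *
        ((W.quadraticTwist (NumberField.discr K : ℚ)).sha).relIndex
          ((((W.quadraticTwist (NumberField.discr K : ℚ)).baseChange K).sha).comap
            (resBaseChange (W.quadraticTwist (NumberField.discr K : ℚ)) K)) ≤ 4)
    {M₀ : ℕ} (hexp : ∀ a ∈ AddCommGroup.primaryComponent (↥W.sha) 2, 2 ^ M₀ • a = 0)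
    (h4 : Nat.card (AddSubgroup.torsionBy (↥W.sha) ((2 : ℕ) : ℤ)) ≤ 4) :
    Finite (AddCommGroup.primaryComponent (↥(W.baseChange K).sha) 2) ∧
      Nat.card (AddCommGroup.primaryComponent (↥(W.baseChange K).sha) 2) ∣ 2 ^ (2 * M₀) := by
  haveI : Fact (Nat.Prime 2) := ⟨Nat.prime_two⟩
  haveI hell : (W.baseChange K).IsElliptic := inferInstanceAs ((W.map (algebraMap ℚ K)).IsElliptic)
  have hdK : (NumberField.discr K : ℚ) ≠ 0 := by exact_mod_cast NumberField.discr_ne_zero K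
  haveI hTell : (W.quadraticTwist (NumberField.discr K : ℚ)).IsElliptic := W.isElliptic_quadraticTwist hdK
  set T := W.quadraticTwist (NumberField.discr K : ℚ) with hTdef
  set Y : AddSubgroup ↥W.sha := AddCommGroup.primaryComponent (↥W.sha) 2 with hY
  set Y' : AddSubgroup ↥T.sha := AddCommGroup.primaryComponent (↥T.sha) 2 with hY'
  -- `#Y' = 1`
  have hY'1 : Nat.card Y' = 1 := by
    rw [Nat.card_eq_one_iff_unique]
    refine ⟨⟨fun a b ↦ Subtype.ext ?_⟩, ⟨⟨0, AddSubgroup.zero_mem _⟩⟩⟩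
    rw [hT0 a.1 a.2, hT0 b.1 b.2]
  haveI hfinT : Finite Y' := Nat.finite_of_card_ne_zero (by rw [hY'1]; exact one_ne_zero)
  obtain ⟨hXfin, hle⟩ := finite_and_two_mul_natCard_sha_le_pair_of_frame W K hIQ hσ1 h2tors hrk y M hndiv hanti hfinT hne hneT
  refine ⟨hXfin, ?_⟩
  haveI := hXfin
  -- `#Y ≤ 4^(M₀)` by the filtration count
  have hYle : Nat.card Y ≤ 4 ^ M₀ := by
    have h := natCard_le_natCard_torsionBy_pow (A := Y) 2
      (fun x ↦ Subtype.ext (by rw [AddSubgroupClass.coe_nsmul, ZeroMemClass.coe_zero]; exact hexp x x.2))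
    have hbr := CasselsTateNumberField.natCard_sha_torsionBy_pow_eq_primaryComponent W 2 1
    rw [pow_one] at hbr
    rw [← hbr] at h
    calc Nat.card Y ≤ Nat.card (AddSubgroup.torsionBy (↥W.sha) ((2 : ℕ) : ℤ)) ^ M₀ := h
      _ ≤ 4 ^ M₀ := Nat.pow_le_pow_left h4 M₀
  -- `2 · #X ≤ 4^(M₀) · 4`
  have h2X : 2 * Nat.card (AddCommGroup.primaryComponent (↥(W.baseChange K).sha) 2) ≤ 4 ^ M₀ * 4 := by
    calc 2 * Nat.card (AddCommGroup.primaryComponent (↥(W.baseChange K).sha) 2)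
        ≤ (Nat.card Y * (W.sha).relIndex (((W.baseChange K).sha).comap (resBaseChange W K))) *
            (Nat.card Y' * (T.sha).relIndex (((T.baseChange K).sha).comap (resBaseChange T K))) := hle
      _ = Nat.card Y * ((W.sha).relIndex (((W.baseChange K).sha).comap (resBaseChange W K)) *
            (T.sha).relIndex (((T.baseChange K).sha).comap (resBaseChange T K))) := by rw [hY'1, one_mul, mul_assoc]
      _ ≤ 4 ^ M₀ * 4 := Nat.mul_le_mul hYle hbudget
  -- `#X = 4^t`, so `t ≤ M₀`
  obtain ⟨k, hk⟩ := exists_natCard_addPrimaryComponent_eq_pow (A := ↥(W.baseChange K).sha) 2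
  obtain ⟨r, hr⟩ := CasselsTateNumberField.isSquare_natCard_primaryComponent_sha (W.baseChange K) 2
  have hr2 : r * r = 2 ^ k := by rw [← hr, hk]
  obtain ⟨t, -, rfl⟩ := (Nat.dvd_prime_pow Nat.prime_two).mp (⟨r, hr2.symm⟩ : r ∣ 2 ^ k)
  have ht : Nat.card (AddCommGroup.primaryComponent (↥(W.baseChange K).sha) 2) = 2 ^ (2 * t) := by rw [hr, ← pow_add, two_mul]
  rw [ht] at h2X ⊢
  have h2X' : 2 ^ (2 * t + 1) ≤ 2 ^ (2 * M₀ + 2) := by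
    calc 2 ^ (2 * t + 1) = 2 * 2 ^ (2 * t) := by ring
      _ ≤ 4 ^ M₀ * 4 := h2X
      _ = 2 ^ (2 * M₀ + 2) := by rw [pow_add, pow_mul]; norm_num
  have htM : 2 * t + 1 ≤ 2 * M₀ + 2 := (Nat.pow_le_pow_iff_right (by norm_num)).mp h2X'
  exact Nat.pow_dvd_pow 2 (by omega)

end Counts

/-! ## §4 The two budgets: `Δ < 0` (LINE 19's cut) and `Δ > 0` (the Tamagawa-odd twin, archimedean bit) -/

section Budgets

variable (W : WeierstrassCurve ℚ) [W.IsElliptic] [W.IsGloballyMinimal] (K : Type) [Field K] [NumberField K]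

/-- **The budget on `Δ < 0`**: `W` globally minimal with `C(W)` odd and `Δ_W < 0`, `K` imaginary quadratic with odd `d_K` and Heegner for
`N_W`, `Wd = Cd • W^(d_K)` any model: both relaxed indices are non-zero and at most `2^(ord₂ C(Wd))` (gk2-p3 g17/g18), hence their product is
`≤ 4` when `ord₂ C(Wd) ≤ 1`.  [cite: Kramer1981, §2 Prop. 3 and Thm. 1] -/
theorem relIndex_mul_relIndex_le_four_of_Δ_neg (hΔ : W.Δ < 0) (hIQ : IsImaginaryQuadratic K) (hodd : Odd (NumberField.discr K))
    (hHe : SatisfiesHeegnerHypothesis (W.conductorNorm ℤ) K) (hT : Odd W.tamagawaProduct)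
    {Wd : WeierstrassCurve ℚ} [Wd.IsElliptic] (Cd : VariableChange ℚ) (hWd : Cd • W.quadraticTwist (NumberField.discr K : ℚ) = Wd)
    (hDEF : padicValNat 2 Wd.tamagawaProduct ≤ 1) :
    haveI := W.isElliptic_quadraticTwist (show (NumberField.discr K : ℚ) ≠ 0 by exact_mod_cast NumberField.discr_ne_zero K)
    (W.sha).relIndex (((W.baseChange K).sha).comap (resBaseChange W K)) ≠ 0 ∧
      ((W.quadraticTwist (NumberField.discr K : ℚ)).sha).relIndex
          ((((W.quadraticTwist (NumberField.discr K : ℚ)).baseChange K).sha).comap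
            (resBaseChange (W.quadraticTwist (NumberField.discr K : ℚ)) K)) ≠ 0 ∧
      (W.sha).relIndex (((W.baseChange K).sha).comap (resBaseChange W K)) *
        ((W.quadraticTwist (NumberField.discr K : ℚ)).sha).relIndex
          ((((W.quadraticTwist (NumberField.discr K : ℚ)).baseChange K).sha).comap
            (resBaseChange (W.quadraticTwist (NumberField.discr K : ℚ)) K)) ≤ 4 := by
  have hdK : (NumberField.discr K : ℚ) ≠ 0 := by exact_mod_cast NumberField.discr_ne_zero K
  haveI hTell : (W.quadraticTwist (NumberField.discr K : ℚ)).IsElliptic := W.isElliptic_quadraticTwist hdK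
  obtain ⟨hne, hle⟩ := relIndex_sha_comap_resBaseChange_le_two_pow_padicValNat_tamagawaProduct_twin_of_Δ_neg W K hΔ hIQ hodd hHe hT Cd hWd
  obtain ⟨hne', hle'⟩ := relIndex_sha_comap_resBaseChange_twin_le_two_pow W (K := K) hΔ hIQ hodd hHe hT
    (Wd := W.quadraticTwist (NumberField.discr K : ℚ)) 1 (one_smul _ _)
  -- `ord₂ C(T) = ord₂ C(Wd)` (both are the genus budget)
  have heq : padicValNat 2 (W.quadraticTwist (NumberField.discr K : ℚ)).tamagawaProduct = padicValNat 2 Wd.tamagawaProduct := by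
    have h1 := prod_ncard_roots_add_one_eq_two_pow_padicValNat_tamagawaProduct_twin W hIQ hodd hHe hT
      (Wd := W.quadraticTwist (NumberField.discr K : ℚ)) 1 (one_smul _ _)
    have h2' := prod_ncard_roots_add_one_eq_two_pow_padicValNat_tamagawaProduct_twin W hIQ hodd hHe hT Cd hWd
    exact Nat.pow_right_injective le_rfl (h1.symm.trans h2')
  rw [heq] at hle'
  refine ⟨hne, hne', ?_⟩
  have h22 : 2 ^ padicValNat 2 Wd.tamagawaProduct ≤ 2 := by
    calc 2 ^ padicValNat 2 Wd.tamagawaProduct ≤ 2 ^ 1 := Nat.pow_le_pow_right (by norm_num) hDEF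
      _ = 2 := pow_one 2
  calc _ ≤ 2 ^ padicValNat 2 Wd.tamagawaProduct * 2 ^ padicValNat 2 Wd.tamagawaProduct := Nat.mul_le_mul hle hle'
    _ ≤ 2 * 2 := Nat.mul_le_mul h22 h22

/-- **The budget on `Δ > 0` (and, in fact, for any sign): the ARCHIMEDEAN BIT.**  `W` globally minimal with `C(W)` odd, `K` imaginary quadratic
with odd `d_K` and Heegner for `N_W`, `Wd = Cd • W^(d_K)` any model: both relaxed indices are non-zero and at most `2^(ord₂ C(Wd) + 1)`
(gk2-p3 g18's `…_of_arch` with the torsor-level archimedean bit of pen g12, `archimedeanBit_sha_comap_resBaseChange`); hence their product is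
`≤ 4` when `ord₂ C(Wd) = 0` — the TAMAGAWA-ODD twin (on `Δ > 0` every prime of `d_K` is then silent).  [cite: Kramer1981, §2 Prop. 3 and Thm. 1]
[cite: MilneADT2006, I Rem. 3.7] -/
theorem relIndex_mul_relIndex_le_four_of_padicValNat_eq_zero (hIQ : IsImaginaryQuadratic K) (hodd : Odd (NumberField.discr K))
    (hHe : SatisfiesHeegnerHypothesis (W.conductorNorm ℤ) K) (hT : Odd W.tamagawaProduct)
    {Wd : WeierstrassCurve ℚ} [Wd.IsElliptic] (Cd : VariableChange ℚ) (hWd : Cd • W.quadraticTwist (NumberField.discr K : ℚ) = Wd)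
    (hDEF : padicValNat 2 Wd.tamagawaProduct = 0) :
    haveI := W.isElliptic_quadraticTwist (show (NumberField.discr K : ℚ) ≠ 0 by exact_mod_cast NumberField.discr_ne_zero K)
    (W.sha).relIndex (((W.baseChange K).sha).comap (resBaseChange W K)) ≠ 0 ∧
      ((W.quadraticTwist (NumberField.discr K : ℚ)).sha).relIndex
          ((((W.quadraticTwist (NumberField.discr K : ℚ)).baseChange K).sha).comap
            (resBaseChange (W.quadraticTwist (NumberField.discr K : ℚ)) K)) ≠ 0 ∧
      (W.sha).relIndex (((W.baseChange K).sha).comap (resBaseChange W K)) *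
        ((W.quadraticTwist (NumberField.discr K : ℚ)).sha).relIndex
          ((((W.quadraticTwist (NumberField.discr K : ℚ)).baseChange K).sha).comap
            (resBaseChange (W.quadraticTwist (NumberField.discr K : ℚ)) K)) ≤ 4 := by
  have hdK : (NumberField.discr K : ℚ) ≠ 0 := by exact_mod_cast NumberField.discr_ne_zero K
  haveI hTell : (W.quadraticTwist (NumberField.discr K : ℚ)).IsElliptic := W.isElliptic_quadraticTwist hdK
  obtain ⟨hne, hle⟩ := relIndex_sha_comap_resBaseChange_le_two_pow_succ_of_arch W K hIQ hodd hHe hT Cd hWd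
    (archimedeanBit_sha_comap_resBaseChange W K)
  obtain ⟨hne', hle'⟩ := relIndex_sha_comap_resBaseChange_twin_le_two_pow_succ_of_arch W K hIQ hodd hHe hT
    (Wd := W.quadraticTwist (NumberField.discr K : ℚ)) 1 (one_smul _ _)
    (archimedeanBit_sha_comap_resBaseChange (W.quadraticTwist (NumberField.discr K : ℚ)) K)
  have heq : padicValNat 2 (W.quadraticTwist (NumberField.discr K : ℚ)).tamagawaProduct = padicValNat 2 Wd.tamagawaProduct := by
    have h1 := prod_ncard_roots_add_one_eq_two_pow_padicValNat_tamagawaProduct_twin W hIQ hodd hHe hT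
      (Wd := W.quadraticTwist (NumberField.discr K : ℚ)) 1 (one_smul _ _)
    have h2' := prod_ncard_roots_add_one_eq_two_pow_padicValNat_tamagawaProduct_twin W hIQ hodd hHe hT Cd hWd
    exact Nat.pow_right_injective le_rfl (h1.symm.trans h2')
  rw [heq] at hle'
  rw [hDEF, zero_add, pow_one] at hle hle'
  exact ⟨hne, hne', Nat.mul_le_mul hle hle'⟩

end Budgets

end Summit.BirchSwinnertonDyer.BirchSwinnertonDyer.Theorems.GenusExact.PlusDescent

end
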